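import Mathlib.Analysis.Calculus.ContDiff.Bounds
import Literature.Geometry.Lorentzian.KerrDerivativeDecayLeafEquiv
import Literature.Geometry.Lorentzian.KerrSliceAgmon
import Literature.Geometry.Lorentzian.KerrSliceHardy
import HarnessLib

/-!
# DRSR Corollary 3.1 (31) through `Σ̃_τ(h♯_{R₁})` from the higher-order energy decay
# estimates: the assembly of the pointwise decay rate `τ^{-2+δ}` of the first derivatives

(statement group **gr.S24**; namespace `Literature.Geometry.Lorentzian.Kerr`, glue in
`Literature.Geometry.Lorentzian`)

This file does for the *derivative* estimate (31) of Dafermos–Rodnianski–Shlapentokh-Rothman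
(arXiv:1402.7034 = Ann. of Math. 183 (2016), "DRSR", §3.3, Cor. 3.1),
`sup_{Σ̃_τ ∩ {r ≤ R}} |n_Σ̃ ψ| + |∇_Σ̃ ψ| ≤ C E τ^{-2+δ}`, vendored in coordinate form as the named
fact `Literature.Geometry.Lorentzian.drsr_wave_derivative_decay_kerr` (`KerrWaveDecay.lean`),
what `KerrPointwiseDecayHierarchy.lean` and `KerrSliceAgmon.lean` do for the pointwise estimate
(30): it **proves** the real-variable assembly of Moschidis' detailed treatment
(arXiv:1509.08489 = Ann. PDE 2 (2016), §9.9: the proof of Cor. 9.2 for `m = 1` from Thm. 9.1 and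
the Gagliardo–Nirenberg inequality, Lemma 9.10) on the concrete objects of the tree, leaving as
the *only* hypothesis the energy-level input — the decay `τ^{-4+2δ}` of the whole-leaf energies
of orders two and three through the hyperboloidal leaves `Σ̃_τ(h♯_{R₁})` (Moschidis Thm. 9.1
with `d = 3`, `q = 2`, `m ≤ 1`; on Kerr the second estimate of DRSR Cor. 3.1 with its commuted
versions) together with the a priori decay along each leaf supplied by the radiation field
(Thm. 7.1). The Gagliardo–Nirenberg (Agmon) inequality on the leaves is the *theorem*
`Kerr.gagliardoNirenberg_slice` of `KerrSliceAgmon.lean`; nothing classical is assumed.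

* `Kerr.drsr_corollary_3_1_scri_derivative_decay_of_leafEnergy_decay` (**proved**): the
  hypotheses (D) — verbatim the hypothesis of the (30)-assembly
  `Kerr.drsr_corollary_3_1_scri_pointwise_decay_of_leafEnergy_decay`: (D1) first-order and (D2)
  second-order leaf energy decay, (D3) a priori decay of `‖y‖|Ψ_τ|`, `‖y‖‖DΨ_τ‖` — and (D′) —
  (D4) third-order leaf energy decay `∫_S ‖D³Ψ_τ‖² dy ≤ C_δ τ^{-4+2δ}` (`D³Ψ_τ(y)` the third
  differential as a trilinear map, `iteratedFDeriv ℝ 3`), (D5) the a priori bound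
  `‖y‖‖D²Ψ_τ‖ ≤ C₀` on each leaf — imply **(31) on the whole leaf, in the Cartesian frame adapted
  to it**: for `τ ≥ 1` and every `y` in the slice region `S = {r(0, ·) > r₊}`,
  `(TΨ)_τ(y)² + ‖DΨ_τ(y)‖² ≤ C τ^{-4+2δ}`, where `Ψ_τ(y) = ψ(τ + h♯_{R₁}(y), y)` is the leaf
  function (`Kerr.leafFun`), `DΨ_τ` its (tangential) differential and `(TΨ)_τ` the leaf function
  of `Tψ = ∂_{t*}ψ` — the square of Moschidis' `sup_{{t̄=τ}} |∇_g φ|²_h ≲ τ^{-4}` (Cor. 9.2,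
  `d = 3`, `m = 1`; on Kerr, §1.3.3: `sup_{Σ̃_τ} (|Nφ| + |∇_{Σ̃} φ|) ≤ C √E τ⁻²`) up to the frame
  constants and the loss `2δ`;
* `Literature.Geometry.Lorentzian.drsr_wave_derivative_decay_kerr_of_leafEnergy_decay`
  (**proved**): (D) ∧ (D′) ⟹ the gr.S24 named fact `drsr_wave_derivative_decay_kerr` (on the
  flat part `{‖y‖ < R₁}` of the leaves `Ψ_τ(y) = ψ(τ, y)`, so that `(TΨ)_τ² + ‖DΨ_τ‖² = ∑_μ (∂_μψ)²`
  is the coordinate energy density; the data of an admissible wave lie in some ball, and `R₁`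
  is taken beyond it and beyond the given radius, DRSR p. 51), and hence its two vendored
  consequences (`drsr_wave_polynomial_decay_kerr`, `drsr_wave_local_energy_decay_kerr`);
* `Kerr.scri_leaf_derivative_decay_of_leafEnergy_decay` (**proved**): (D) ∧ (D′) ⟹ (31) *as
  printed*, `sup_{Σ̃_τ(h♯_{R₁}) ∩ {r₊ < r ≤ R}} |n_Σ̃ ψ| + |∇_Σ̃ ψ|_ḡ ≤ C τ^{-2+δ}` for `R < R₁` (the
  normal and tangential derivatives to the leaf, `PseudoRiemannianMetric.unitNormalDeriv`,
  `….tangentialGradSq` of `KerrDerivativeDecay.lean`), through the equivalence of that leaf form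
  with the named fact (`KerrDerivativeDecayLeafEquiv.lean`).

So the two pointwise statements of DRSR Cor. 3.1 now rest on one explicit energy-decay
hypothesis of the same shape — (D1)–(D3) for (30), (D2)–(D5) for (31) —, each clause of which is
a whole-leaf `L²` statement of the printed improved-decay hierarchy; a literature seat vendoring
Moschidis Thm. 9.1 (`q = 2`, `m ≤ 1`) and Thm. 7.1 on Kerr in this Cartesian form closes both by
`exact`. No definition and no named fact is introduced (D-0026: written from the proving seat of
`drsr_wave_derivative_decay_kerr`).

## The argument (Moschidis §9.9, `d = 3`, `m = 1`, with the loss `2δ`)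

Fix `R₁ ≥ R₀`, an admissible `ψ` with ball data, `δ > 0` and `τ ≥ 1`; write `Ψ = Ψ_τ`. The time
derivative `Tψ` is again an admissible wave with data in the same ball
(`IsAdmissibleKerrWave.timeDeriv`, `Kerr.HasBallData.timeDeriv`), so (D) applies to it as well.
Apply the Agmon inequality `Φ(y)² ≤ C_GN (√I₁(Φ) √I₂(Φ) + I₂(Φ))`, `I₁(Φ) = ∫_S ‖DΦ‖²`,
`I₂(Φ) = ∫_S ‖D²Φ‖²` (`Kerr.gagliardoNirenberg_slice`; hypotheses: `Φ` smooth on `S`, `‖y‖|Φ|`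
and `‖y‖‖DΦ‖` bounded on `S`, `I₁, I₂ < ∞`) to the four functions `Φ₀ = (TΨ)_τ` and
`Φᵢ = ∂ᵢΨ_τ = DΨ_τ(·)(eᵢ)`, `i = 1, 2, 3`:
* `Φ₀`: `I₁ = ∫‖D(TΨ)_τ‖² ≤ leafHessEnergy[ψ](τ) ≤ C_δ τ^{-4+2δ}` ((D2) for `ψ`),
  `I₂ = ∫‖D²(TΨ)_τ‖² ≤ leafHessEnergy[Tψ](τ) ≤ C'_δ τ^{-4+2δ}` ((D2) for `Tψ`), and the a priori
  bounds are (D3) for `Tψ`;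
* `Φᵢ`: `‖DΦᵢ‖ ≤ ‖D²Ψ‖` and `‖D²Φᵢ‖ ≤ ‖D³Ψ‖` pointwise on `S` (`Kerr.norm_fderiv_partial_le`,
  `Kerr.norm_fderiv_fderiv_partial_le`), so `I₁ ≤ leafHessEnergy[ψ](τ) ≤ C_δ τ^{-4+2δ}` ((D2)),
  `I₂ ≤ ∫_S ‖D³Ψ_τ‖² ≤ C''_δ τ^{-4+2δ}` ((D4)), and the a priori bounds follow from the gradient
  clause of (D3) and from (D5);
whence each `Φ_μ(y)² ≤ C_GN (√c √c' + c') τ^{-4+2δ}` (`Kerr.sq_le_of_gagliardoNirenberg`) and,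
summing (`‖DΨ_τ(y)‖² = ∑ᵢ Φᵢ(y)²`, `norm_sq_eq_sum_sq_apply_single`), the whole-leaf bound. On
`{‖y‖ < R₁}` the height `h♯_{R₁}` vanishes identically (`Kerr.scriHeight_eq_zero_of_norm_le`), so
`Ψ_τ = ψ̃(τ, ·)` near `y`, `Φᵢ(y) = ∂ᵢψ̃(τ, y)` (chain rule through `y ↦ (τ, y)`), `Φ₀(y) =
∂₀ψ̃(τ, y)`, and the left side is `coordEnergyDensity ψ (τ, y)`; for a given admissible wave
(data supported in `{‖x⃗‖ ≤ ρ}`) and coordinate radius `R` one takes `R₁ = max(R₀, ρ, |R| + 1)`,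
as in `KerrDerivativeDecay.lean` and `KerrPointwiseDecay.lean`.

## The energy-level hypotheses (D′) and their derivation from print

(D4)–(D5) complete (D1)–(D3) of `KerrPointwiseDecayHierarchy.lean` (whose docstring *The two
analytic inputs* derives those from DRSR Cor. 3.1 / Moschidis Thms. 7.1, 8.1, 9.1) by one order.
**(D4)** is the `j = 1`, `(j₂, j₃) = (2, 0)` term of Moschidis' non-degenerate energy
`𝓔_en^{(0,2,1)}[φ](τ) ⊇ ∫_{{t̄=τ}} |∇³_{h_{τ,N}} φ|²_{h_{τ,N}} dh_N` (arXiv:1509.08489, §9.2),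
which Thm. 9.1 (`d = 3`, `q = 2`, `m = 1`, `F = 0`) bounds by
`≲_ε τ^{-4+C₁ε} 𝓔_bound^{(4,2,1+7⌈2δ₀⁻¹⌉k)}[φ](0)`, finite for smooth compactly supported data
(Thm. 7.1), applicable to subextremal Kerr by his §1.3.3 ("this spacetime satisfies all the
geometric assumptions of Theorems … by applying Theorems 8.1 and 9.1 one can thus readily upgrade
these results to polynomial decay estimates … and therefore establish Corollary 3.1 of [DRSR]",
printed there with `sup_{Σ̃_τ} (|Nφ| + |∇_{Σ̃} φ|) ≤ C √E τ⁻²`); on Kerr this is the second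
estimate of DRSR Cor. 3.1, `∫_{Σ̃_τ∩{r≤R}} J^N[Nψ] n ≤ C E τ^{-4+2δ}`, with its `T`-, `N`- and
`Ω̃`-commuted versions and the elliptic estimate (29) of Thm. 3.2 (DRSR p. 14: "apply the black
box [arXiv:0910.4957, §4–5] … see [Schlue], [Moschidis] for detailed treatments"). **(D5)** is
the a priori boundedness of `‖y‖‖D²Ψ_τ‖` along each leaf: on the compact part by smoothness up
to `𝓗⁺`, far out by the asymptotics at `𝓘⁺` along the asymptotically null leaves (Thm. 7.1,
finite radiation field with its tangential derivatives: second tangential derivatives of `Ψ_τ`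
decay faster than `r⁻²`). **The Cartesian rendering** is that of
`KerrPointwiseDecayHierarchy.lean` ((a)–(d): `h_{τ,N} ≃ δ`, `dh_N ≃ dy` uniformly on `S`,
`N ↦ T = ∂_{t*}`), with one precision which matters for (31): covariant and Cartesian derivatives
of orders two and three differ by `Γ ⋆ D²Ψ` and `(∂Γ + Γ ⋆ Γ) ⋆ DΨ` with `|Γ| ≲ (1 + r)⁻²`,
`|∂Γ| ≲ (1 + r)⁻³`, and the resulting *first-order* terms `∫_S (1 + r)⁻⁴ ‖DΨ‖² dy` are controlled
by the second-order covariant energy itself — by Kato's inequality `|d|∇φ|_h| ≤ |∇²φ|_h` and the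
Hardy inequality on the leaf, `∫ r⁻² |∇φ|²_h dh_N ≤ C ∫ |∇²φ|²_h dh_N` for `r|∇φ|² → 0` (radial
integration from infinity over the exterior of the convex horizon ellipsoid, boundary term of the
favourable sign; arXiv:1509.08489, Lemma 12.3; `KerrSliceHardy.lean` for the Cartesian model) —
so that (D2) and (D4) follow from Thm. 9.1 together with the decay clauses (D3), (D5), *without*
the appeal to (31) for the local first-order energy made in rendering note (c) of
`KerrPointwiseDecayHierarchy.lean`; in particular the present reduction of (31) is not circular.
Hypotheses (D), (D′) assert less than the sources (existential, `ψ`-dependent constants; one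
foliation; compactly supported data).

## References

* M. Dafermos, I. Rodnianski, Y. Shlapentokh-Rothman, *Decay for solutions of the wave equation
  on Kerr exterior spacetimes III: the full subextremal case `|a| < M`*, Ann. of Math. 183 (2016)
  787–913, arXiv:1402.7034: §3.3, Cor. 3.1 (31), p. 14 (the black box), p. 51 (`Σ̃₀` agrees
  with `Σ₀` on `{r ≤ R}`) (key `DafermosRodnianskiShlapentokhrothman2014`).
* G. Moschidis, *The `r^p`-weighted energy method of Dafermos and Rodnianski in general
  asymptotically flat spacetimes and applications*, Ann. PDE 2 (2016), arXiv:1509.08489: §1.3.3,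
  Thm. 7.1, §9.2 (`𝓔_en^{(p,q,m)}`), Thm. 9.1, Cor. 9.2 (`d` odd, `m ≥ 1`:
  `sup_{{t̄=τ}} |∇^m_g φ|²_h ≲ τ^{-d-1} 𝓔_{m+2,d}[φ](0)`), §9.9 (its proof: Gagliardo–Nirenberg
  for `∂^i φ`), Lemma 9.10, Lemma 12.3 (key `Moschidis2016`).
* M. Dafermos, I. Rodnianski, *A new physical-space approach to decay for the wave equation with
  applications to black hole spacetimes*, arXiv:0910.4957, §5 (pointwise estimates by
  commutation with `T`, `N` and Sobolev inequalities) (key `DafermosRodnianski2010ICMP`).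
-/

noncomputable section

open Set Filter MeasureTheory Metric TopologicalSpace
open scoped Topology ENNReal Manifold ContDiff

namespace Literature.Geometry.Lorentzian

namespace Kerr

/-! ### Calculus: the partial derivatives `∂_v f = Df(·)(v)` of a smooth function -/

section Calculus

variable {E F : Type*} [NormedAddCommGroup E] [NormedSpace ℝ E] [NormedAddCommGroup F]
  [NormedSpace ℝ F]

/-- `‖D²f(x)‖ = ‖D(Df)(x)‖` for the iterated derivative. [folklore] -/
theorem norm_iteratedFDeriv_two_eq (f : E → F) (x : E) :
    ‖iteratedFDeriv ℝ 2 f x‖ = ‖fderiv ℝ (fderiv ℝ f) x‖ := by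
  rw [← norm_iteratedFDeriv_one (𝕜 := ℝ) (fderiv ℝ f)]
  exact (norm_iteratedFDeriv_fderiv (𝕜 := ℝ) (n := 1) (f := f) (x := x)).symm

/-- A partial derivative `x ↦ Df(x)(v)` of a `C^{n+1}` function is `C^n`. [folklore] -/
theorem contDiffAt_partial {f : E → ℝ} {x : E} {n : ℕ∞} (hf : ContDiffAt ℝ (n + 1) f x) (v : E) :
    ContDiffAt ℝ n (fun z ↦ fderiv ℝ f z v) x :=
  (hf.fderiv_right (m := n) le_rfl).clm_apply contDiffAt_const

/-- A partial derivative of a `C^∞` function is `C^∞`. [folklore] -/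
theorem contDiffAt_partial_infty {f : E → ℝ} {x : E} (hf : ContDiffAt ℝ ∞ f x) (v : E) :
    ContDiffAt ℝ ∞ (fun z ↦ fderiv ℝ f z v) x := by
  rw [contDiffAt_infty] at hf ⊢
  intro n
  have h := contDiffAt_partial (n := n) (f := f) (x := x) (by exact_mod_cast hf (n + 1)) v
  exact_mod_cast h

/-- **`‖D(∂_v f)(x)‖ ≤ ‖v‖ ‖D²f(x)‖`** for `f` smooth at `x`
(`norm_iteratedFDeriv_clm_apply_const`). [folklore] -/
theorem norm_fderiv_partial_le {f : E → ℝ} {x : E} (hf : ContDiffAt ℝ ∞ f x) (v : E) :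
    ‖fderiv ℝ (fun z ↦ fderiv ℝ f z v) x‖ ≤ ‖v‖ * ‖fderiv ℝ (fderiv ℝ f) x‖ := by
  have hf3 : ContDiffAt ℝ 3 f x := hf.of_le (by norm_cast)
  have hf' : ContDiffAt ℝ 2 (fderiv ℝ f) x := hf3.fderiv_right (m := 2) le_rfl
  have h := norm_iteratedFDeriv_clm_apply_const (f := fderiv ℝ f) (c := v) (n := 1) hf'
    (mod_cast one_le_two)
  rw [norm_iteratedFDeriv_one, norm_iteratedFDeriv_one] at h
  exact h

/-- **`‖D²(∂_v f)(x)‖ ≤ ‖v‖ ‖D³f(x)‖`** for `f` smooth at `x`, `D³f(x)` the third differential as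
a trilinear map (`iteratedFDeriv ℝ 3`; `norm_iteratedFDeriv_clm_apply_const`). [folklore] -/
theorem norm_fderiv_fderiv_partial_le {f : E → ℝ} {x : E} (hf : ContDiffAt ℝ ∞ f x) (v : E) :
    ‖fderiv ℝ (fderiv ℝ (fun z ↦ fderiv ℝ f z v)) x‖ ≤ ‖v‖ * ‖iteratedFDeriv ℝ 3 f x‖ := by
  have hf3 : ContDiffAt ℝ 3 f x := hf.of_le (by norm_cast)
  have hf' : ContDiffAt ℝ 2 (fderiv ℝ f) x := hf3.fderiv_right (m := 2) le_rfl
  have h := norm_iteratedFDeriv_clm_apply_const (f := fderiv ℝ f) (c := v) (n := 2) hf'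
    (mod_cast le_rfl)
  rw [norm_iteratedFDeriv_two_eq, norm_iteratedFDeriv_fderiv] at h
  exact h

/-- `|∂_v f(x)| ≤ ‖v‖ ‖Df(x)‖`. [folklore] -/
theorem abs_partial_le (f : E → ℝ) (x v : E) : |fderiv ℝ f x v| ≤ ‖v‖ * ‖fderiv ℝ f x‖ := by
  rw [← Real.norm_eq_abs, mul_comm]
  exact (fderiv ℝ f x).le_opNorm v

end Calculus

/-! ### Bookkeeping of the constants -/

/-- The Gagliardo–Nirenberg right-hand side with both integrals decaying at the same rate:
`√(c₁ t) √(c₂ t) + c₂ t = (√c₁ √c₂ + c₂) t` (`c₁, c₂, t ≥ 0`). [folklore] -/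
theorem sqrt_mul_sqrt_add_eq {c₁ c₂ t : ℝ} (hc₁ : 0 ≤ c₁) (hc₂ : 0 ≤ c₂) (ht : 0 ≤ t) :
    Real.sqrt (c₁ * t) * Real.sqrt (c₂ * t) + c₂ * t = (Real.sqrt c₁ * Real.sqrt c₂ + c₂) * t := by
  rw [Real.sqrt_mul hc₁, Real.sqrt_mul hc₂]
  have h : Real.sqrt t * Real.sqrt t = t := Real.mul_self_sqrt ht
  calc Real.sqrt c₁ * Real.sqrt t * (Real.sqrt c₂ * Real.sqrt t) + c₂ * t
      = Real.sqrt c₁ * Real.sqrt c₂ * (Real.sqrt t * Real.sqrt t) + c₂ * t := by ring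
    _ = (Real.sqrt c₁ * Real.sqrt c₂ + c₂) * t := by rw [h]; ring

/-- **From the Gagliardo–Nirenberg bound to a decay bound**: if `u² ≤ C_GN (√I₁ √I₂ + I₂)` with
`I₁ ≤ c₁ τ^p`, `I₂ ≤ c₂ τ^p` (`τ ≥ 0`, `C_GN ≥ 0`), then
`u² ≤ C_GN (√(c₁⁺) √(c₂⁺) + c₂⁺) τ^p`, `c⁺ = max(c, 0)`. [folklore] -/
theorem sq_le_of_gagliardoNirenberg {u Cg c₁ c₂ τ p : ℝ} {I₁ I₂ : ℝ≥0∞} (hCg : 0 ≤ Cg) (hτ : 0 ≤ τ)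
    (hu : u ^ 2 ≤ Cg * (Real.sqrt I₁.toReal * Real.sqrt I₂.toReal + I₂.toReal))
    (h₁ : I₁ ≤ ENNReal.ofReal (c₁ * τ ^ p)) (h₂ : I₂ ≤ ENNReal.ofReal (c₂ * τ ^ p)) :
    u ^ 2 ≤ Cg * (Real.sqrt (max c₁ 0) * Real.sqrt (max c₂ 0) + max c₂ 0) * τ ^ p := by
  have hI₁ : I₁.toReal ≤ max c₁ 0 * τ ^ p := toReal_le_max_mul_rpow hτ h₁
  have hI₂ : I₂.toReal ≤ max c₂ 0 * τ ^ p := toReal_le_max_mul_rpow hτ h₂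
  have htp : 0 ≤ τ ^ p := Real.rpow_nonneg hτ p
  calc u ^ 2 ≤ Cg * (Real.sqrt I₁.toReal * Real.sqrt I₂.toReal + I₂.toReal) := hu
    _ ≤ Cg * (Real.sqrt (max c₁ 0 * τ ^ p) * Real.sqrt (max c₂ 0 * τ ^ p) + max c₂ 0 * τ ^ p) := by
        gcongr
    _ = Cg * (Real.sqrt (max c₁ 0) * Real.sqrt (max c₂ 0) + max c₂ 0) * τ ^ p := by
        rw [sqrt_mul_sqrt_add_eq (le_max_right _ _) (le_max_right _ _) htp]; ring

/-! ### Two more integrals dominated by the second-order leaf energy -/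

/-- The integral of `‖D(TΨ)_τ‖²` over `S` is at most the second-order leaf energy of `ψ`.
[folklore] -/
theorem lintegral_fderiv_timeDeriv_sq_le_leafHessEnergy (M a : ℝ) (h : E3 → ℝ)
    (ψ : region a (rPlus M a) → ℝ) (τ : ℝ) :
    (∫⁻ y in (slice a (rPlus M a) : Set E3),
        ENNReal.ofReal (‖fderiv ℝ (leafFun M a h (timeDeriv ψ) τ) y‖ ^ 2)) ≤
      leafHessEnergy M a h ψ τ :=
  lintegral_mono fun y ↦ ENNReal.ofReal_le_ofReal (by
    have h1 := sq_nonneg ‖fderiv ℝ (fderiv ℝ (leafFun M a h ψ τ)) y‖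
    have h2 := mul_nonneg (sq_nonneg ‖y‖⁻¹)
      (sq_nonneg (leafFun M a h (timeDeriv (timeDeriv ψ)) τ y))
    linarith)

/-! ### The assembly: (31) on the whole leaf `Σ̃_τ(h♯_{R₁})` from (D) and (D′) -/

section assembly

variable
  /- (D): the hypothesis of the (30)-assembly, verbatim. -/
  (hD : ∀ [Facts] [SliceFacts] (M a : ℝ), IsSubextremal M a →
      ∃ R₀ : ℝ, rPlus M a < R₀ ∧ ∀ R₁ : ℝ, R₀ ≤ R₁ →
        ∀ ψ : region a (rPlus M a) → ℝ, Literature.Geometry.Lorentzian.IsAdmissibleKerrWave M a ψ →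
          HasBallData M a R₁ ψ →
            -- (D1) first-order leaf energy: DRSR Cor. 3.1, first estimate / Moschidis Thm. 8.1
            (∃ C : ℝ, ∀ τ : ℝ, 1 ≤ τ →
              leafGradEnergy M a (scriHeight M a R₁) ψ τ ≤ ENNReal.ofReal (C * τ ^ (-2 : ℝ))) ∧
            -- (D2) second-order leaf energy, improved decay: Cor. 3.1, second estimate /
            -- Moschidis Thm. 9.1, q = 2
            (∀ δ : ℝ, 0 < δ → ∃ C : ℝ, ∀ τ : ℝ, 1 ≤ τ →
              leafHessEnergy M a (scriHeight M a R₁) ψ τ ≤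
                ENNReal.ofReal (C * τ ^ (-4 + 2 * δ))) ∧
            -- (D3) a priori decay along each leaf: Cor. 3.1, third estimate; radiation field
            (∀ τ : ℝ, 1 ≤ τ → ∃ C₀ : ℝ, ∀ y ∈ (slice a (rPlus M a) : Set E3),
              ‖y‖ * |leafFun M a (scriHeight M a R₁) ψ τ y| ≤ C₀ ∧
                ‖y‖ * ‖fderiv ℝ (leafFun M a (scriHeight M a R₁) ψ τ) y‖ ≤ C₀))
  /- (D′): the third-order completion. -/
  (hD' : ∀ [Facts] [SliceFacts] (M a : ℝ), IsSubextremal M a →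
      ∃ R₀ : ℝ, rPlus M a < R₀ ∧ ∀ R₁ : ℝ, R₀ ≤ R₁ →
        ∀ ψ : region a (rPlus M a) → ℝ, Literature.Geometry.Lorentzian.IsAdmissibleKerrWave M a ψ →
          HasBallData M a R₁ ψ →
            -- (D4) third-order leaf energy, improved decay: Moschidis Thm. 9.1, q = 2, m = 1 /
            -- DRSR Cor. 3.1, second estimate, commuted, with Thm. 3.2 (29)
            (∀ δ : ℝ, 0 < δ → ∃ C : ℝ, ∀ τ : ℝ, 1 ≤ τ →
              (∫⁻ y in (slice a (rPlus M a) : Set E3), ENNReal.ofReal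
                  (‖iteratedFDeriv ℝ 3 (leafFun M a (scriHeight M a R₁) ψ τ) y‖ ^ 2)) ≤
                ENNReal.ofReal (C * τ ^ (-4 + 2 * δ))) ∧
            -- (D5) a priori decay of the leaf Hessian along each leaf: radiation field (Thm. 7.1)
            (∀ τ : ℝ, 1 ≤ τ → ∃ C₀ : ℝ, ∀ y ∈ (slice a (rPlus M a) : Set E3),
              ‖y‖ * ‖fderiv ℝ (fderiv ℝ (leafFun M a (scriHeight M a R₁) ψ τ)) y‖ ≤ C₀))

include hD hD'

/-- **DRSR Corollary 3.1 (31) on the whole leaf `Σ̃_τ(h♯_{R₁})`, Cartesian leaf frame, from the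
energy decay estimates.** Under the hypotheses (D) (= the hypothesis of
`Kerr.drsr_corollary_3_1_scri_pointwise_decay_of_leafEnergy_decay`: DRSR Cor. 3.1, estimates 1–3,
with Moschidis Thms. 7.1, 8.1, 9.1) and (D′) ((D4) third-order leaf energy decay, Moschidis Thm. 9.1
with `q = 2`, `m = 1`; (D5) a priori bound `‖y‖‖D²Ψ_τ‖ ≤ C₀`, Thm. 7.1), documented in the module
docstring: for `|a| < M` there is `R₀ > r₊` such that for `R₁ ≥ R₀`, every admissible `ψ` with
data in `{‖y‖ ≤ R₁}` and every `δ > 0` there is `C` with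
`(TΨ)_τ(y)² + ‖DΨ_τ(y)‖² ≤ C τ^{-4+2δ}` for all `τ ≥ 1` and all `y ∈ S = {r(0, ·) > r₊}`
(`Ψ_τ = leafFun … ψ τ`, `(TΨ)_τ = leafFun … (timeDeriv ψ) τ` along `Σ̃_τ(h♯_{R₁})`). This is the
argument of Moschidis, arXiv:1509.08489, §9.9 (Cor. 9.2, `d = 3`, `m = 1`:
`sup_{{t̄=τ}} |∇_g φ|²_h ≲ τ^{-4}`) run on the concrete quantities with the Agmon inequality
`Kerr.gagliardoNirenberg_slice` applied to `(TΨ)_τ` and to the three partial derivatives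
`∂ᵢΨ_τ`; `Tψ` is again admissible with ball data (`IsAdmissibleKerrWave.timeDeriv`,
`HasBallData.timeDeriv`), so (D2), (D3) for `Tψ` supply `∫‖D²(TΨ)_τ‖²` and the a priori bounds of
`(TΨ)_τ`. [cite: Moschidis2016, Cor. 9.2 with §9.9; DafermosRodnianskiShlapentokhrothman2014 §3.3 Cor. 3.1 (31)] -/
theorem drsr_corollary_3_1_scri_derivative_decay_of_leafEnergy_decay :
    ∀ [Facts] [SliceFacts] (M a : ℝ), IsSubextremal M a →
      ∃ R₀ : ℝ, rPlus M a < R₀ ∧ ∀ R₁ : ℝ, R₀ ≤ R₁ →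
        ∀ ψ : region a (rPlus M a) → ℝ, Literature.Geometry.Lorentzian.IsAdmissibleKerrWave M a ψ →
          HasBallData M a R₁ ψ → ∀ δ : ℝ, 0 < δ →
            ∃ C : ℝ, ∀ τ : ℝ, 1 ≤ τ → ∀ y ∈ (slice a (rPlus M a) : Set E3),
              (leafFun M a (scriHeight M a R₁) (timeDeriv ψ) τ y) ^ 2 +
                  ‖fderiv ℝ (leafFun M a (scriHeight M a R₁) ψ τ) y‖ ^ 2 ≤
                C * τ ^ (-4 + 2 * δ) := by
  intro _ _ M a hMa
  obtain ⟨R₀, hR₀, hDψ⟩ := hD M a hMa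
  obtain ⟨R₀', hR₀', hD'ψ⟩ := hD' M a hMa
  refine ⟨max R₀ R₀', lt_max_of_lt_left hR₀, fun R₁ hR₁ ψ hψ hball δ hδ ↦ ?_⟩
  have hR₀₁ : R₀ ≤ R₁ := (le_max_left _ _).trans hR₁
  have hR₀₁' : R₀' ≤ R₁ := (le_max_right _ _).trans hR₁
  have hR₁' : rPlus M a < R₁ := hR₀.trans_le hR₀₁
  have hM : 0 ≤ M := hMa.pos.le
  -- `Tψ` is admissible with data in the same ball
  have hTψ : Literature.Geometry.Lorentzian.IsAdmissibleKerrWave M a (timeDeriv ψ) :=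
    hψ.timeDeriv hM
  have hballT : HasBallData M a R₁ (timeDeriv ψ) := HasBallData.timeDeriv hM hψ hball
  obtain ⟨-, hD2, hD3⟩ := hDψ R₁ hR₀₁ ψ hψ hball
  obtain ⟨-, hD2T, hD3T⟩ := hDψ R₁ hR₀₁ (timeDeriv ψ) hTψ hballT
  obtain ⟨hD4, hD5⟩ := hD'ψ R₁ hR₀₁' ψ hψ hball
  obtain ⟨C₂, hC₂⟩ := hD2 δ hδ
  obtain ⟨C₂', hC₂'⟩ := hD2T δ hδ
  obtain ⟨C₄, hC₄⟩ := hD4 δ hδ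
  obtain ⟨Cg, hCg, hGN⟩ := gagliardoNirenberg_slice M a hMa
  -- the constant
  set KT : ℝ := Cg * (Real.sqrt (max C₂ 0) * Real.sqrt (max C₂' 0) + max C₂' 0) with hKT
  set KS : ℝ := Cg * (Real.sqrt (max C₂ 0) * Real.sqrt (max C₄ 0) + max C₄ 0) with hKS
  refine ⟨KT + 3 * KS, fun τ hτ y hyS ↦ ?_⟩
  have hτ0 : 0 ≤ τ := zero_le_one.trans hτ
  have hSm : MeasurableSet (slice a (rPlus M a) : Set E3) :=
    (slice a (rPlus M a)).isOpen.measurableSet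
  set Ψ : E3 → ℝ := leafFun M a (scriHeight M a R₁) ψ τ with hΨ
  set ΨT : E3 → ℝ := leafFun M a (scriHeight M a R₁) (timeDeriv ψ) τ with hΨT
  have hΨs : ∀ z ∈ (slice a (rPlus M a) : Set E3), ContDiffAt ℝ ∞ Ψ z := fun z hz ↦
    leafFun_contDiffAt hMa hR₁' hψ.1 τ hz
  -- the time derivative: Agmon for `Φ₀ = (TΨ)_τ`
  have hT : ΨT y ^ 2 ≤ KT * τ ^ (-4 + 2 * δ) := by
    have hreg : ContDiffOn ℝ ∞ ΨT (slice a (rPlus M a) : Set E3) :=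
      leafFun_contDiffOn hMa hR₁' hTψ.1 τ
    have hI₁ : (∫⁻ z in (slice a (rPlus M a) : Set E3), ENNReal.ofReal (‖fderiv ℝ ΨT z‖ ^ 2)) ≤
        ENNReal.ofReal (C₂ * τ ^ (-4 + 2 * δ)) :=
      (lintegral_fderiv_timeDeriv_sq_le_leafHessEnergy M a _ ψ τ).trans (hC₂ τ hτ)
    have hI₂ : (∫⁻ z in (slice a (rPlus M a) : Set E3),
        ENNReal.ofReal (‖fderiv ℝ (fderiv ℝ ΨT) z‖ ^ 2)) ≤
          ENNReal.ofReal (C₂' * τ ^ (-4 + 2 * δ)) :=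
      (lintegral_fderiv_fderiv_sq_le_leafHessEnergy M a _ (timeDeriv ψ) τ).trans (hC₂' τ hτ)
    have hGNy := hGN ΨT hreg (hD3T τ hτ) (hI₁.trans_lt ENNReal.ofReal_lt_top)
      (hI₂.trans_lt ENNReal.ofReal_lt_top) y hyS
    exact sq_le_of_gagliardoNirenberg hCg hτ0 hGNy hI₁ hI₂
  -- the spatial partial derivatives: Agmon for `Φᵢ = ∂ᵢΨ_τ`
  have hS : ∀ i : Fin 3, (fderiv ℝ Ψ y (EuclideanSpace.single i (1 : ℝ))) ^ 2 ≤
      KS * τ ^ (-4 + 2 * δ) := by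
    intro i
    set v : E3 := EuclideanSpace.single i (1 : ℝ) with hv
    have hv1 : ‖v‖ = 1 := by rw [hv]; simp
    set Φ : E3 → ℝ := fun z ↦ fderiv ℝ Ψ z v with hΦ
    have hreg : ContDiffOn ℝ ∞ Φ (slice a (rPlus M a) : Set E3) := fun z hz ↦
      (contDiffAt_partial_infty (hΨs z hz) v).contDiffWithinAt
    -- pointwise domination on `S`
    have hd1 : ∀ z ∈ (slice a (rPlus M a) : Set E3),
        ‖fderiv ℝ Φ z‖ ≤ ‖fderiv ℝ (fderiv ℝ Ψ) z‖ := fun z hz ↦ by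
      simpa [hv1] using norm_fderiv_partial_le (hΨs z hz) v
    have hd2 : ∀ z ∈ (slice a (rPlus M a) : Set E3),
        ‖fderiv ℝ (fderiv ℝ Φ) z‖ ≤ ‖iteratedFDeriv ℝ 3 Ψ z‖ := fun z hz ↦ by
      simpa [hv1] using norm_fderiv_fderiv_partial_le (hΨs z hz) v
    -- a priori bounds from (D3) (gradient clause) and (D5)
    have hdec : ∃ C₀ : ℝ, ∀ z ∈ (slice a (rPlus M a) : Set E3),
        ‖z‖ * |Φ z| ≤ C₀ ∧ ‖z‖ * ‖fderiv ℝ Φ z‖ ≤ C₀ := by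
      obtain ⟨C₀, hC₀⟩ := hD3 τ hτ
      obtain ⟨C₅, hC₅⟩ := hD5 τ hτ
      refine ⟨max C₀ C₅, fun z hz ↦ ⟨?_, ?_⟩⟩
      · calc ‖z‖ * |Φ z| ≤ ‖z‖ * ‖fderiv ℝ Ψ z‖ := by
              refine mul_le_mul_of_nonneg_left ?_ (norm_nonneg _)
              simpa [hv1] using abs_partial_le Ψ z v
          _ ≤ max C₀ C₅ := ((hC₀ z hz).2).trans (le_max_left _ _)
      · calc ‖z‖ * ‖fderiv ℝ Φ z‖ ≤ ‖z‖ * ‖fderiv ℝ (fderiv ℝ Ψ) z‖ :=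
              mul_le_mul_of_nonneg_left (hd1 z hz) (norm_nonneg _)
          _ ≤ max C₀ C₅ := (hC₅ z hz).trans (le_max_right _ _)
    -- the two integrals
    have hI₁ : (∫⁻ z in (slice a (rPlus M a) : Set E3), ENNReal.ofReal (‖fderiv ℝ Φ z‖ ^ 2)) ≤
        ENNReal.ofReal (C₂ * τ ^ (-4 + 2 * δ)) := by
      refine le_trans ?_ ((lintegral_fderiv_fderiv_sq_le_leafHessEnergy M a _ ψ τ).trans (hC₂ τ hτ))
      exact setLIntegral_mono' hSm fun z hz ↦
        ENNReal.ofReal_le_ofReal (by have h := hd1 z hz; gcongr)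
    have hI₂ : (∫⁻ z in (slice a (rPlus M a) : Set E3),
        ENNReal.ofReal (‖fderiv ℝ (fderiv ℝ Φ) z‖ ^ 2)) ≤
          ENNReal.ofReal (C₄ * τ ^ (-4 + 2 * δ)) := by
      refine le_trans ?_ (hC₄ τ hτ)
      exact setLIntegral_mono' hSm fun z hz ↦
        ENNReal.ofReal_le_ofReal (by have h := hd2 z hz; gcongr)
    have hGNy := hGN Φ hreg hdec (hI₁.trans_lt ENNReal.ofReal_lt_top)
      (hI₂.trans_lt ENNReal.ofReal_lt_top) y hyS
    exact sq_le_of_gagliardoNirenberg hCg hτ0 hGNy hI₁ hI₂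
  -- sum
  have hsum : ‖fderiv ℝ Ψ y‖ ^ 2 ≤ 3 * KS * τ ^ (-4 + 2 * δ) := by
    rw [norm_sq_eq_sum_sq_apply_single]
    calc ∑ i : Fin 3, (fderiv ℝ Ψ y (EuclideanSpace.single i (1 : ℝ))) ^ 2
        ≤ ∑ _i : Fin 3, KS * τ ^ (-4 + 2 * δ) := Finset.sum_le_sum fun i _ ↦ hS i
      _ = 3 * KS * τ ^ (-4 + 2 * δ) := by
          rw [Finset.sum_const, Finset.card_univ, Fintype.card_fin, nsmul_eq_mul]
          push_cast
          ring
  calc ΨT y ^ 2 + ‖fderiv ℝ Ψ y‖ ^ 2 ≤ KT * τ ^ (-4 + 2 * δ) + 3 * KS * τ ^ (-4 + 2 * δ) :=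
        add_le_add hT hsum
    _ = (KT + 3 * KS) * τ ^ (-4 + 2 * δ) := by ring

/-- **DRSR's pointwise derivative decay (coordinate form) from the energy decay estimates**: under
(D) and (D′) (module docstring) the gr.S24 named fact
`Literature.Geometry.Lorentzian.drsr_wave_derivative_decay_kerr` (`KerrWaveDecay.lean`; DRSR
Cor. 3.1 (31)) holds. Given an admissible `ψ` (data supported in `{‖x⃗‖ ≤ ρ}`,
`exists_spatialNorm_le_of_isCompact`), `δ > 0` and a coordinate radius `R`, take
`R₁ = max(R₀, ρ, |R| + 1)`, so that `ψ` has ball data of radius `R₁` and every slice point `(τ, y)`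
with `‖y‖ ≤ R` has `‖y‖ < R₁`; there `h♯_{R₁}` vanishes near `y`
(`Kerr.scriHeight_eq_zero_of_norm_le`), the leaf function is `Ψ_τ = ψ̃(τ, ·)` near `y`, so
`DΨ_τ(y)(eᵢ) = ∂_{i}ψ̃(τ, y)` (chain rule through `y ↦ (τ, y)`, `E4.hasFDerivAt_ofTimeSpace`) and
`(TΨ)_τ(y) = ∂₀ψ̃(τ, y)`, whence
`coordEnergyDensity ψ (τ, y) = (TΨ)_τ(y)² + ‖DΨ_τ(y)‖² ≤ C τ^{-4+2δ}` by
`Kerr.drsr_corollary_3_1_scri_derivative_decay_of_leafEnergy_decay`. DRSR arXiv:1402.7034, §3.3,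
Cor. 3.1 (31) and p. 51. [cite: DafermosRodnianskiShlapentokhrothman2014, Cor. 3.1 (31); Moschidis2016 Cor. 9.2] -/
theorem _root_.Literature.Geometry.Lorentzian.drsr_wave_derivative_decay_kerr_of_leafEnergy_decay :
    drsr_wave_derivative_decay_kerr := by
  intro _ _ M a hMa ψ hψ δ hδ R
  obtain ⟨R₀, hR₀, hcor⟩ :=
    drsr_corollary_3_1_scri_derivative_decay_of_leafEnergy_decay hD hD' M a hMa
  -- a coordinate ball containing the support of the data
  obtain ⟨K, hK, hsupp⟩ := hψ.2.2
  obtain ⟨ρ, hρ, hKρ⟩ := exists_spatialNorm_le_of_isCompact hK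
  set R₁ : ℝ := max R₀ (max ρ (|R| + 1)) with hR₁
  have hR₀₁ : R₀ ≤ R₁ := le_max_left _ _
  have hρ₁ : ρ ≤ R₁ := (le_max_left _ _).trans (le_max_right _ _)
  have hRR₁ : |R| + 1 ≤ R₁ := (le_max_right _ _).trans (le_max_right _ _)
  have hR₁nn : 0 ≤ R₁ := hρ.trans hρ₁
  have hdata : HasBallData M a R₁ ψ := by
    intro x hx0 hxR
    refine hsupp x hx0 fun hxK ↦ ?_
    have := hKρ x hxK
    linarith
  obtain ⟨C, hC⟩ := hcor R₁ hR₀₁ ψ hψ hdata δ hδ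
  refine ⟨C, fun τ hτ y hy hyR ↦ ?_⟩
  have hyS : y ∈ (slice a (rPlus M a) : Set E3) := ofTimeSpace_mem_region_iff.1 hy
  have hyR₁ : ‖y‖ < R₁ := by
    have : ‖y‖ ≤ |R| := hyR.trans (le_abs_self R)
    linarith
  have hbound := hC τ hτ y hyS
  set h : E3 → ℝ := scriHeight M a R₁ with hh
  set Φ : E4 → ℝ := Function.extend Subtype.val ψ 0 with hΦ
  -- on the ball `{‖y'‖ < R₁}` the leaf function is the slice function `ψ̃(τ, ·)`
  have hEq : leafFun M a h ψ τ =ᶠ[𝓝 y] fun y' ↦ Φ (E4.ofTimeSpace τ y') := by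
    filter_upwards [isOpen_ball.mem_nhds (mem_ball_zero_iff.2 hyR₁)] with y' hy'
    show Function.extend Subtype.val ψ 0 (leafPoint h τ y') = Φ (E4.ofTimeSpace τ y')
    rw [leafPoint_of_eq_zero (scriHeight_eq_zero_of_norm_le hR₁nn (mem_ball_zero_iff.1 hy').le)]
  have hΦd : DifferentiableAt ℝ Φ (E4.ofTimeSpace τ y) :=
    (contDiffAt_extend hψ.1 ⟨_, hy⟩).differentiableAt (by simp)
  have hDf : fderiv ℝ (leafFun M a h ψ τ) y =
      (fderiv ℝ Φ (E4.ofTimeSpace τ y)).comp E4.spaceEmbed := by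
    rw [hEq.fderiv_eq]
    exact (hΦd.hasFDerivAt.comp y (E4.hasFDerivAt_ofTimeSpace τ y)).fderiv
  have hspatial : ∀ i : Fin 3, fderiv ℝ (leafFun M a h ψ τ) y (EuclideanSpace.single i (1 : ℝ)) =
      fderiv ℝ Φ (E4.ofTimeSpace τ y) (EuclideanSpace.single i.succ (1 : ℝ)) := fun i ↦ by
    rw [hDf, ContinuousLinearMap.coe_comp, Function.comp_apply, E4.spaceEmbed_apply,
      E4.ofTimeSpace_zero_single]
  -- the time derivative at the slice point
  have h0 : h y = 0 := scriHeight_eq_zero_of_norm_le hR₁nn hyR₁.le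
  have htime : leafFun M a h (timeDeriv ψ) τ y =
      fderiv ℝ Φ (E4.ofTimeSpace τ y) (EuclideanSpace.single 0 (1 : ℝ)) := by
    show Function.extend Subtype.val (timeDeriv ψ) 0 (leafPoint h τ y) = _
    rw [leafPoint_of_eq_zero h0]
    exact (extend_rep (timeDeriv ψ) ⟨E4.ofTimeSpace τ y, hy⟩).symm
  -- the coordinate energy density is the sum of the squares of the four components
  have hsplit : coordEnergyDensity (exterior M a) ψ (E4.ofTimeSpace τ y) =
      (leafFun M a h (timeDeriv ψ) τ y) ^ 2 + ‖fderiv ℝ (leafFun M a h ψ τ) y‖ ^ 2 := by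
    rw [norm_sq_eq_sum_sq_apply_single, htime]
    simp_rw [hspatial]
    rw [coordEnergyDensity]
    exact Fin.sum_univ_succ _
  rw [hsplit]
  exact hbound

/-- Corollary: under (D) and (D′) the local coordinate energy of `BlackHoles.lean` decays like
`τ⁻²` (`Literature.Geometry.Lorentzian.drsr_wave_polynomial_decay_kerr`, via
`drsr_wave_polynomial_decay_kerr_of_derivative_decay` of `KerrWaveDecay.lean`). DRSR
arXiv:1402.7034, Cor. 3.1. [cite: DafermosRodnianskiShlapentokhrothman2014, Cor. 3.1] -/
theorem _root_.Literature.Geometry.Lorentzian.drsr_wave_polynomial_decay_kerr_of_leafEnergy_decay' :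
    drsr_wave_polynomial_decay_kerr :=
  drsr_wave_polynomial_decay_kerr_of_derivative_decay
    (drsr_wave_derivative_decay_kerr_of_leafEnergy_decay hD hD')

/-- Corollary: under (D) and (D′) the local coordinate energy tends to zero
(`Literature.Geometry.Lorentzian.drsr_wave_local_energy_decay_kerr`, via
`drsr_wave_local_energy_decay_kerr_of_derivative_decay` of `KerrWaveDecay.lean`). DRSR
arXiv:1402.7034, Cor. 3.1. [cite: DafermosRodnianskiShlapentokhrothman2014, Cor. 3.1] -/
theorem
    _root_.Literature.Geometry.Lorentzian.drsr_wave_local_energy_decay_kerr_of_leafEnergy_decay' :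
    drsr_wave_local_energy_decay_kerr :=
  drsr_wave_local_energy_decay_kerr_of_derivative_decay
    (drsr_wave_derivative_decay_kerr_of_leafEnergy_decay hD hD')

/-- **DRSR Corollary 3.1 (31) as printed, on the flat part of the leaves `Σ̃_τ(h♯_{R₁})`, from
the energy decay estimates**: under (D) and (D′), for `|a| < M` there is `R₀ > 0` such that for
`R₁ ≥ R₀`, every admissible `ψ` with data in `{‖y‖ ≤ R₁}`, every `δ > 0` and every radius
`r₊ < R < R₁` there is `C` with `|n_Σ̃ ψ|(p) + |∇_Σ̃ ψ|_ḡ(p) ≤ C τ^{-2+δ}` (`τ ≥ 1`) at the exterior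
points `p` of `Σ̃_τ(h♯_{R₁}) ∩ {r ≤ R}` — the normal derivative and the length of the tangential
gradient with respect to the leaf (`PseudoRiemannianMetric.unitNormalDeriv`, `….tangentialGradSq`,
`KerrDerivativeDecay.lean`), i.e. the printed quantity of (31) for the hyperboloidal foliation of
DRSR p. 51 (which agrees with the Kerr–Schild slices on `{r ≤ R₁}`): compose
`drsr_wave_derivative_decay_kerr_of_leafEnergy_decay` with the converse reduction
`Kerr.scri_leaf_derivative_decay_of_drsr_wave_derivative_decay_kerr`
(`KerrDerivativeDecayLeafEquiv.lean`). [cite: DafermosRodnianskiShlapentokhrothman2014, Cor. 3.1 (31) and p. 51; Moschidis2016 Cor. 9.2] -/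
theorem scri_leaf_derivative_decay_of_leafEnergy_decay :
    ∀ [Facts] [SliceFacts] (M a : ℝ), IsSubextremal M a →
      ∃ R₀ : ℝ, 0 < R₀ ∧ ∀ R₁ : ℝ, R₀ ≤ R₁ →
        ∀ ψ : region a (rPlus M a) → ℝ, Literature.Geometry.Lorentzian.IsAdmissibleKerrWave M a ψ →
          HasBallData M a R₁ ψ → ∀ δ : ℝ, 0 < δ → ∀ R : ℝ, rPlus M a < R → R < R₁ →
            ∃ C : ℝ, ∀ τ : ℝ, 1 ≤ τ →
              ∀ (y : E3) (hy : leafPoint (scriHeight M a R₁) τ y ∈ region a (rPlus M a)),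
                radius a (leafPoint (scriHeight M a R₁) τ y) ≤ R →
                  |(smoothMetric M a (rPlus M a)).unitNormalDeriv ψ
                      ⟨leafPoint (scriHeight M a R₁) τ y, hy⟩
                      (leafNormal M a (scriHeight M a R₁) ⟨leafPoint (scriHeight M a R₁) τ y, hy⟩)| +
                    Real.sqrt ((smoothMetric M a (rPlus M a)).tangentialGradSq ψ
                      ⟨leafPoint (scriHeight M a R₁) τ y, hy⟩
                      (leafNormal M a (scriHeight M a R₁)
                        ⟨leafPoint (scriHeight M a R₁) τ y, hy⟩)) ≤
                    C * τ ^ (-2 + δ) :=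
  fun M a hMa ↦ scri_leaf_derivative_decay_of_drsr_wave_derivative_decay_kerr
    (drsr_wave_derivative_decay_kerr_of_leafEnergy_decay hD hD') M a hMa

end assembly

end Kerr

end Literature.Geometry.Lorentzian

end
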